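import Mathlib
import Summits.MatrixMultiplication.MatrixMultiplication.Theorems.ThinBlockAlphaThinPackingsOrbitCriterion
import Summits.MatrixMultiplication.MatrixMultiplication.Theorems.ThinBlockAlphaThinPackingsOrbitStubCharCount
import Summits.MatrixMultiplication.MatrixMultiplication.Theorems.ThinBlockAlphaThinPackingsOrbitStubCharParseval
import Summits.MatrixMultiplication.MatrixMultiplication.Theorems.ThinBlockAlphaThinPackingsOrbitStubLargeCoeff
import Summits.MatrixMultiplication.MatrixMultiplication.Theorems.ThinBlockAlphaThinPackingsOrbitStubInvariantCoeff
import Summits.MatrixMultiplication.MatrixMultiplication.Theorems.ThinBlockAlphaThinPackingsOrbitStubSolCount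
import Summits.MatrixMultiplication.MatrixMultiplication.Theorems.ThinBlockAlphaThinPackingsOrbitStubLegCard

set_option linter.dupNamespace false

/-!
# The Fourier cap on orbit designs — stub `stub_orbitGainCap` (lead's assembly F7)

Crux `stmt-MatrixMultiplication-10595` (`Theses.ThinBlockAlpha.ThinPackings`), line `Ideator4Sketch`
(card `automorphism-orbit-twisted-templates`), lead a3, 2026-08-16.

THEOREM.  Let a finite group `Γ` act on a finite abelian group `H` by additive automorphisms and let
`(A, B, C)` be a template which is TPP (`TemplateTPP`) and `Γ`-twisted sum-free (`TwistedSumFree`) — an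
ORBIT DESIGN.  If every nontrivial character `ψ` of `H` is stabilised by at most `S` elements of `Γ`
(`ψ ∘ g = ψ` for at most `S` values of `g`), and the design is not absurdly small
(`2|H| ≤ |Γ|²·|A||B||C|`), then
                    `|Γ|⁴ · (|A||B||C|)² ≤ 4 · S · |H|³`,
i.e. the GAIN `γ = |Γ|·|A||B||C| / |H|` obeys `γ² ≤ 4 S |H| / |Γ|²`.

PROOF (assembled from the landed stubs F1–F6).  Let `X = Γ·(A − B)`, `Y = Γ·(B − C)`, `Z = Γ·(C − A)`
(sizes `|Γ||A||B|`, `|Γ||B||C|`, `|Γ||C||A|`, F6) and `T = #{x + y + z = 0}` on `X × Y × Z`; every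
solution is a `Γ`-translate of a trivial one, so `T ≤ |Γ|·|A||B||C|` (F5), whereas the trivial
character alone contributes `|X||Y||Z|/|H| = |Γ|³V²/|H| ≥ 2|Γ|V` to the character-sum identity
`∑_ψ X̂ŶẐ = |H|·T` (F1).  Hence the nontrivial characters carry at least `|X||Y||Z|/2`, and by
Cauchy–Schwarz + Parseval (F2, F3) some `ψ ≠ 0` has `‖X̂(ψ)‖ ≥ |X|√(|Y||Z|)/(2|H|)`.  The set `X` is
`Γ`-invariant, so all `≥ |Γ|/S` characters `ψ ∘ g` share this coefficient, and Parseval pays: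
`|Γ|·‖X̂(ψ)‖² ≤ S·|H|·|X|` (F4).  Combining, `|Γ|·|X||Y||Z| ≤ 4·S·|H|³`.
-/

namespace Summit.MatrixMultiplication.MatrixMultiplication.Theorems.ThinPackings.Orbit

open Finset
open scoped Pointwise


section Assembly

variable {Γ H : Type} [Group Γ] [Fintype Γ] [AddCommGroup H] [Fintype H] [DecidableEq H]
  [DistribMulAction Γ H]

omit [Fintype Γ] [Fintype H] [DecidableEq H] in
/-- A twisted-sum-free template with all three legs nonempty lives in a nontrivial host as soon as
`Γ` is nontrivial: otherwise `g • (a − b) + (b − c) + (c − a) = 0` for `g ≠ 1`. -/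
theorem nontrivial_host_of_twistedSumFree {A B C : Finset H} (hTw : TwistedSumFree Γ A B C)
    (hA : A.Nonempty) (hB : B.Nonempty) (hC : C.Nonempty) {g : Γ} (hg : g ≠ 1)
    (hH : ∀ x y : H, x = y) : False := by
  obtain ⟨a, ha⟩ := hA
  obtain ⟨b, hb⟩ := hB
  obtain ⟨c, hc⟩ := hC
  exact hTw g 1 (by simp [hg]) a ha b hb b hb c hc c hc a ha (hH _ _)

omit [Fintype H] [DecidableEq H] in
/-- The character sum of the trivial character is the cardinality. -/
theorem charSum_zero (X : Finset H) : ∑ x ∈ X, (0 : AddChar H ℂ) x = (X.card : ℂ) := by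
  simp only [AddChar.zero_apply, Finset.sum_const, nsmul_eq_mul, mul_one]

/-- The real-arithmetic endgame of the Fourier cap: from the deficit bound, the large coefficient
and the orbit/Parseval bound to `γ⁴ V² ≤ 4 S h³`. -/
theorem gainCap_arith {γ h V x y z u T S : ℝ} (hγ : 0 < γ) (hh : 0 < h) (hV : 0 < V)
    (hy : 0 ≤ y) (hz : 0 ≤ z)
    (hxyz : x * y * z = γ ^ 3 * V ^ 2) (hbig : 2 * h ≤ γ ^ 2 * V) (hT : T ≤ γ * V)
    (hψ : x * y * z - h * T ≤ u * Real.sqrt (h * y * (h * z)))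
    (h2 : γ * u ^ 2 ≤ S * (h * x)) : γ ^ 4 * V ^ 2 ≤ 4 * S * h ^ 3 := by
  have hD0 : 0 ≤ γ ^ 3 * V ^ 2 / 2 := by positivity
  have hD : γ ^ 3 * V ^ 2 / 2 ≤ x * y * z - h * T := by
    rw [hxyz]
    have : h * T ≤ h * (γ * V) := by gcongr
    nlinarith [mul_le_mul_of_nonneg_right hbig (le_of_lt (mul_pos hγ hV))]
  have hsq : Real.sqrt (h * y * (h * z)) ^ 2 = h * y * (h * z) := Real.sq_sqrt (by positivity)
  have h1 : (γ ^ 3 * V ^ 2 / 2) ^ 2 ≤ u ^ 2 * (h * y * (h * z)) := by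
    calc (γ ^ 3 * V ^ 2 / 2) ^ 2 ≤ (u * Real.sqrt (h * y * (h * z))) ^ 2 :=
          pow_le_pow_left₀ hD0 (hD.trans hψ) 2
      _ = u ^ 2 * (h * y * (h * z)) := by rw [mul_pow, hsq]
  have h3 : (γ ^ 3 * V ^ 2 / 2) ^ 2 * γ ≤ S * h ^ 3 * (γ ^ 3 * V ^ 2) := by
    calc (γ ^ 3 * V ^ 2 / 2) ^ 2 * γ ≤ u ^ 2 * (h * y * (h * z)) * γ := by gcongr
      _ = (γ * u ^ 2) * (h * y * (h * z)) := by ring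
      _ ≤ (S * (h * x)) * (h * y * (h * z)) := by gcongr
      _ = S * h ^ 3 * (x * y * z) := by ring
      _ = S * h ^ 3 * (γ ^ 3 * V ^ 2) := by rw [hxyz]
  have hpos : 0 < γ ^ 3 * V ^ 2 := by positivity
  have : γ ^ 4 * V ^ 2 * (γ ^ 3 * V ^ 2) ≤ 4 * S * h ^ 3 * (γ ^ 3 * V ^ 2) := by
    have e : γ ^ 4 * V ^ 2 * (γ ^ 3 * V ^ 2) = 4 * ((γ ^ 3 * V ^ 2 / 2) ^ 2 * γ) := by ring
    rw [e]; linarith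
  exact le_of_mul_le_mul_right this hpos

/-- **Registered stub `stub_orbitGainCap`** (F7, the Fourier cap on orbit designs), verbatim. -/
theorem stub_orbitGainCap : ∀ {Γ H : Type} [Group Γ] [Fintype Γ] [AddCommGroup H] [Fintype H] [DecidableEq H] [DistribMulAction Γ H] (A B C : Finset H) (S : ℕ), TemplateTPP A B C → TwistedSumFree Γ A B C → 0 < S → (∀ ψ : AddChar H ℂ, ψ ≠ 0 → ∀ T : Finset Γ, (∀ g ∈ T, ψ.compAddMonoidHom (DistribSMul.toAddMonoidHom H g) = ψ) → T.card ≤ S) → 2 * Fintype.card H ≤ Fintype.card Γ ^ 2 * (A.card * B.card * C.card) → Fintype.card Γ ^ 4 * (A.card * B.card * C.card) ^ 2 ≤ 4 * S * Fintype.card H ^ 3 := by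
  intro Γ H _ _ _ _ _ _ A B C S hT hTw hS hStab hbig
  classical
  -- basic positivity: `|H| ≥ 1`, hence `V = |A||B||C| ≥ 1` and the legs are nonempty
  have hH1 : 1 ≤ Fintype.card H := Fintype.card_pos
  have hV : 0 < A.card * B.card * C.card := by
    rcases Nat.eq_zero_or_pos (A.card * B.card * C.card) with h | h
    · rw [h, mul_zero] at hbig; omega
    · exact h
  have hA : A.Nonempty := card_pos.1 (Nat.pos_of_mul_pos_right (Nat.pos_of_mul_pos_right hV))
  have hB : B.Nonempty := card_pos.1 (Nat.pos_of_mul_pos_left (Nat.pos_of_mul_pos_right hV))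
  have hC : C.Nonempty := card_pos.1 (Nat.pos_of_mul_pos_left hV)
  have hΓ : 0 < Fintype.card Γ := Fintype.card_pos
  -- the host is nontrivial
  have hH2 : 1 < Fintype.card H := by
    by_contra hle
    have hH : Fintype.card H = 1 := by omega
    -- then `V ≤ 1`, so `|Γ| ≥ 2`, giving `g ≠ 1`
    have hA1 : A.card ≤ 1 := (card_le_univ A).trans hH.le
    have hB1 : B.card ≤ 1 := (card_le_univ B).trans hH.le
    have hC1 : C.card ≤ 1 := (card_le_univ C).trans hH.le
    have hV1 : A.card * B.card * C.card ≤ 1 := by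
      calc A.card * B.card * C.card ≤ 1 * 1 * 1 := by gcongr
        _ = 1 := by norm_num
    have hΓ2 : 1 < Fintype.card Γ := by
      by_contra hΓle
      have : Fintype.card Γ = 1 := by omega
      rw [this, hH] at hbig
      omega
    obtain ⟨g, hg⟩ := Fintype.exists_ne_of_one_lt_card hΓ2 (1 : Γ)
    have hsub : ∀ x y : H, x = y := fun x y =>
      Fintype.card_le_one_iff.1 hH.le x y
    exact nontrivial_host_of_twistedSumFree hTw hA hB hC hg hsub
  -- facts about the saturated difference sets `X = Γ(A−B)`, `Y = Γ(B−C)`, `Z = Γ(C−A)`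
  obtain ⟨hXc, hYc, hZc, hinv⟩ := stub_orbitLegCard (Γ := Γ) A B C hA hB hC hT hTw
  have hXinv := hinv A B
  have hTle := stub_solCount (Γ := Γ) A B C hT hTw
  have hF1 := stub_charCount (H := H)
    (((univ : Finset Γ) ×ˢ (A ×ˢ B)).image fun p => p.1 • (p.2.1 - p.2.2))
    (((univ : Finset Γ) ×ˢ (B ×ˢ C)).image fun p => p.1 • (p.2.1 - p.2.2))
    (((univ : Finset Γ) ×ˢ (C ×ˢ A)).image fun p => p.1 • (p.2.1 - p.2.2))
  have hPX := stub_charParseval (H := H)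
    (((univ : Finset Γ) ×ˢ (A ×ˢ B)).image fun p => p.1 • (p.2.1 - p.2.2))
  have hPY := stub_charParseval (H := H)
    (((univ : Finset Γ) ×ˢ (B ×ˢ C)).image fun p => p.1 • (p.2.1 - p.2.2))
  have hPZ := stub_charParseval (H := H)
    (((univ : Finset Γ) ×ˢ (C ×ˢ A)).image fun p => p.1 • (p.2.1 - p.2.2))
  have hF4 := stub_invariantCoeff (Γ := Γ)
    (((univ : Finset Γ) ×ˢ (A ×ˢ B)).image fun p => p.1 • (p.2.1 - p.2.2)) hXinv
  clear hinv
  -- make the three sets opaque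
  generalize (((univ : Finset Γ) ×ˢ (A ×ˢ B)).image fun p => p.1 • (p.2.1 - p.2.2)) = X at *
  generalize (((univ : Finset Γ) ×ˢ (B ×ˢ C)).image fun p => p.1 • (p.2.1 - p.2.2)) = Y at *
  generalize (((univ : Finset Γ) ×ˢ (C ×ˢ A)).image fun p => p.1 • (p.2.1 - p.2.2)) = Z at *
  -- the solution count
  generalize hTdef : (((X ×ˢ Y) ×ˢ Z).filter fun t => t.1.1 + t.1.2 + t.2 = 0).card = T at *
  -- real/complex casts of the sizes
  set γ : ℝ := ((Fintype.card Γ : ℕ) : ℝ) with hγ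
  set h : ℝ := ((Fintype.card H : ℕ) : ℝ) with hh
  set V : ℝ := ((A.card * B.card * C.card : ℕ) : ℝ) with hVdef
  clear_value γ h V
  have hγpos : 0 < γ := by rw [hγ]; exact_mod_cast hΓ
  have hhpos : 0 < h := by rw [hh]; exact_mod_cast hH1
  have hVpos : 0 < V := by rw [hVdef]; exact_mod_cast hV
  have hXr : (X.card : ℝ) = γ * (A.card * B.card) := by rw [hXc]; push_cast; rw [hγ]
  have hYr : (Y.card : ℝ) = γ * (B.card * C.card) := by rw [hYc]; push_cast; rw [hγ]
  have hZr : (Z.card : ℝ) = γ * (C.card * A.card) := by rw [hZc]; push_cast; rw [hγ]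
  have hXYZ : (X.card : ℝ) * Y.card * Z.card = γ ^ 3 * V ^ 2 := by
    rw [hXr, hYr, hZr, hVdef]; push_cast; ring
  -- F3: a large nontrivial coefficient
  obtain ⟨ψ₁, hψ₁⟩ := Fintype.exists_ne_of_one_lt_card
    (by rw [AddChar.card_eq]; exact hH2) (0 : AddChar H ℂ)
  have hK : (∑ ψ : AddChar H ℂ, (∑ x ∈ X, ψ x) * (∑ y ∈ Y, ψ y) * (∑ z ∈ Z, ψ z) : ℂ) =
      ((h * T : ℝ) : ℂ) := by
    rw [hF1, hh]; push_cast; ring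
  have hPv : ∑ ψ : AddChar H ℂ, ‖∑ y ∈ Y, ψ y‖ ^ 2 ≤ h * Y.card := hPY.le
  have hPw : ∑ ψ : AddChar H ℂ, ‖∑ z ∈ Z, ψ z‖ ^ 2 ≤ h * Z.card := hPZ.le
  obtain ⟨ψ, hψ0, hψ⟩ := stub_largeCoeff (0 : AddChar H ℂ) ψ₁
    (fun ψ => ∑ x ∈ X, ψ x) (fun ψ => ∑ y ∈ Y, ψ y) (fun ψ => ∑ z ∈ Z, ψ z)
    (h * T) (h * Y.card) (h * Z.card) hψ₁ hK (by positivity) (by positivity) hPv hPw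
  -- evaluate the trivial character's term
  rw [charSum_zero X, charSum_zero Y, charSum_zero Z] at hψ
  have h0 : ‖((X.card : ℂ)) * (Y.card : ℂ) * (Z.card : ℂ)‖ = (X.card : ℝ) * Y.card * Z.card := by
    rw [← Nat.cast_mul, ← Nat.cast_mul, Complex.norm_natCast]; push_cast; ring
  rw [h0] at hψ
  -- F4: the coefficient is shared by `≥ |Γ|/S` characters
  have hF4' := hF4 ψ S (h * X.card) hS (hStab ψ hψ0) hPX.le
  -- casts and the arithmetic endgame
  have hbigr : 2 * h ≤ γ ^ 2 * V := by
    rw [hh, hγ, hVdef]; exact_mod_cast hbig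
  have hTr : (T : ℝ) ≤ γ * V := by rw [hγ, hVdef]; exact_mod_cast hTle
  have habs : |h * (T : ℝ)| = h * T := abs_of_nonneg (by positivity)
  rw [habs] at hψ
  clear hF1 hF4 hPX hPY hPZ hPv hPw hK hStab hXinv hTdef
  have h4 : γ ^ 4 * V ^ 2 ≤ 4 * S * h ^ 3 :=
    gainCap_arith hγpos hhpos hVpos (Nat.cast_nonneg _) (Nat.cast_nonneg _)
      hXYZ hbigr hTr hψ hF4'
  rw [hγ, hh, hVdef] at h4
  exact_mod_cast h4

end Assembly

end Summit.MatrixMultiplication.MatrixMultiplication.Theorems.ThinPackings.Orbit
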